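import Mathlib
import Summits.HodgeConjecture.CorCM.RMuNormFixedUnits
import Summits.HodgeConjecture.CorCM.RMuNormOddUnit
import Summits.HodgeConjecture.CorCM.RMuNormHermitianUnits
import HarnessLib

/-!
# Involution-compatible bilinear forms on a rank-one free module are twisted trace forms

General-algebra layer of lane RMU-NORM (cell pub-hodgecm2), file 4: the "trace-form duality" step.

Let `E` be a field and `L` a commutative finite-dimensional `E`-algebra whose trace form
`Tr_{L/E}(xy)` is non-degenerate (e.g. `L = E ⊗_F K` for a finite separable field extension
`K/F`, `traceForm_baseChange_nondegenerate`), with an `E`-algebra involution `τ`. Let `B` be an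
`E`-bilinear form on `L` which is `τ`-balanced: `B(x u, v) = B(u, τ(x) v)` (the Rosati
condition). Then

* `exists_eq_trace_mul_mul_map` — `B(x, y) = Tr_{L/E}(x · β · τ y)` for a (unique) `β ∈ L`;
* `map_eq_neg_of_antisymm` — if `B` is antisymmetric then `τ β = -β`;
* `isUnit_of_separatingLeft` — if `B` is left-separating then `β` is a unit;
* `exists_generator_eq_trace` — **capstone** (with files 1–3 of the lane): for `L = E ⊗_F K`,
  `τ = 1 ⊗ ρ`, where the `F`-involution `ρ` of the finite separable extension `K/F` restricts
  along `i : k₁ → K` to a non-trivial involution `c` of a finite extension `k₁/F` all of whose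
  conjugates lie in `E` (`#Hom_F(k₁,E) = [k₁:F]`): every `τ`-balanced, antisymmetric,
  left-separating `E`-bilinear form `B` on a free rank-one `L`-module `H` (given with one
  generator, i.e. an `L`-linear isomorphism `r₀ : L ≃ H`) admits a generator `r : L ≃ₗ[L] H` and
  `β ∈ K` with `ρ β = -β`, `β ≠ 0` and `B(r x, r y) = Tr_{L/E}(x · (1 ⊗ β) · τ y)` for all
  `x, y` — for ANY prescribed such `β` (`exists_generator_eq_trace'` produces one).

Reading (not formalised — no algebraic de Rham homology over a number field in the tree): with
`F = ℚ`, `K = M_μ`, `k₁ = M'_μ`, `E` Liu's CM field assumed Galois over `ℚ`, `H = H₁^dR(A_μ/E)`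
and `B` the `λ_μ`-pairing composed with an `E`-linear trivialisation of `H^dR_{2 dim}(A_μ/E)`,
this is exactly the rigidification `r_μ` of [Liu 2021, Def. 4.5 (2)] bullet 4 («the existence
of `r_μ` is obvious», proof of Prop. 4.6): the only inputs left outside the kernel are that `H`
is free of rank one over `M_μ ⊗ E` and that the `λ_μ`-pairing is `E`-bilinear, alternating,
perfect and Rosati-balanced. The Liu-level statement is filed once, by seat hcmisog-isog-2
(`Literature/NumberTheory/Automorphic/Liu2021/Def45RMuGalois.lean`); this file states no
`Def45`-level theorem. HC_CM is NOT proved; nothing here touches the COR-CM chain. [folklore]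
-/

open scoped TensorProduct

namespace Summit.HodgeConjecture.CorCM.RMuNorm

open Module Algebra.TensorProduct LinearMap

section General

variable {E L : Type*} [Field E] [CommRing L] [Algebra E L]

/-- An `E`-algebra endomorphism `τ` with `τ ∘ τ = id`, as an algebra automorphism. [folklore] -/
theorem exists_algEquiv_of_involutive (τ : L →ₐ[E] L) (hττ : ∀ x, τ (τ x) = x) :
    ∃ e : L ≃ₐ[E] L, ∀ x, e x = τ x :=
  ⟨AlgEquiv.ofAlgHom τ τ (AlgHom.ext fun x => by simp [hττ]) (AlgHom.ext fun x => by simp [hττ]),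
    fun _ => rfl⟩

/-- The trace is invariant under an involutive algebra endomorphism: `Tr(τ x) = Tr(x)`.
[folklore] -/
theorem trace_map_of_involutive (τ : L →ₐ[E] L) (hττ : ∀ x, τ (τ x) = x) (x : L) :
    Algebra.trace E L (τ x) = Algebra.trace E L x := by
  obtain ⟨e, he⟩ := exists_algEquiv_of_involutive τ hττ
  rw [← he, Algebra.trace_eq_of_algEquiv]

/-- **`τ`-balanced forms are twisted trace forms.** If the trace form of the finite-dimensional
commutative `E`-algebra `L` is non-degenerate, `τ` is an involutive `E`-algebra endomorphism of
`L`, and the `E`-bilinear form `B` on `L` satisfies `B(x u, v) = B(u, τ(x) v)`, then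
`B(x, y) = Tr_{L/E}(x · β · τ y)` for some `β ∈ L` (namely `β = τ γ` where `Tr(γ ·) = B(1, ·)`).
[folklore] -/
theorem exists_eq_trace_mul_mul_map [FiniteDimensional E L]
    (hTr : (Algebra.traceForm E L).Nondegenerate)
    (τ : L →ₐ[E] L) (hττ : ∀ x, τ (τ x) = x) (B : LinearMap.BilinForm E L)
    (hB : ∀ x u v, B (x * u) v = B u (τ x * v)) :
    ∃ β : L, ∀ x y, B x y = Algebra.trace E L (x * β * τ y) := by
  -- represent the functional `B 1` by the trace form
  obtain ⟨γ, hγ⟩ : ∃ γ : L, ∀ z, Algebra.trace E L (γ * z) = B 1 z := by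
    refine ⟨(Algebra.traceForm E L).toDual hTr |>.symm (B 1), fun z => ?_⟩
    have h := LinearMap.BilinForm.apply_toDual_symm_apply (B := Algebra.traceForm E L)
      (hB := hTr) (B 1) z
    rwa [Algebra.traceForm_apply] at h
  refine ⟨τ γ, fun x y => ?_⟩
  have h1 : B x y = B 1 (τ x * y) := by rw [← hB x 1 y, mul_one]
  rw [h1, ← hγ, ← trace_map_of_involutive τ hττ (γ * (τ x * y))]
  congr 1
  rw [map_mul τ γ, map_mul τ (τ x), hττ]
  ring

/-- If moreover `B` is antisymmetric, the element `β` with `B(x,y) = Tr(x β τy)` is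
anti-invariant: `τ β = -β` (trace-form non-degeneracy again). [folklore] -/
theorem map_eq_neg_of_antisymm (hTr : (Algebra.traceForm E L).Nondegenerate) (τ : L →ₐ[E] L)
    (hττ : ∀ x, τ (τ x) = x) (B : LinearMap.BilinForm E L) {β : L}
    (hβ : ∀ x y, B x y = Algebra.trace E L (x * β * τ y)) (hanti : ∀ x y, B x y = -B y x) :
    τ β = -β := by
  -- `Tr((β + τ β) z) = 0` for all `z`
  have hsum : ∀ z, Algebra.traceForm E L (β + τ β) z = 0 := by
    intro z
    have h := hanti (τ z) 1
    rw [hβ, hβ, map_one, mul_one, one_mul, hττ] at h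
    -- h : Tr (τ z * β) = - Tr (β * z)
    have h' : Algebra.trace E L (τ z * β) = Algebra.trace E L (z * τ β) := by
      rw [← trace_map_of_involutive τ hττ (τ z * β), map_mul, hττ]
    rw [Algebra.traceForm_apply, add_mul, map_add, mul_comm (τ β) z]
    rw [h'] at h
    linear_combination h
  have h0 : β + τ β = 0 := hTr.1 (β + τ β) hsum
  linear_combination h0

/-- If moreover `B` is left-separating (`B(x, ·) = 0 ⇒ x = 0`), the element `β` is a unit: a
non-unit of a finite-dimensional commutative algebra is a zero divisor. [folklore] -/
theorem isUnit_of_separatingLeft [FiniteDimensional E L] (τ : L →ₐ[E] L)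
    (B : LinearMap.BilinForm E L) {β : L}
    (hβ : ∀ x y, B x y = Algebra.trace E L (x * β * τ y))
    (hsep : ∀ x, (∀ y, B x y = 0) → x = 0) : IsUnit β := by
  -- multiplication by `β` is injective, hence surjective
  have hinj : Function.Injective (LinearMap.mulRight E β) := by
    intro x x' h
    rw [← sub_eq_zero]
    apply hsep
    intro y
    have h0 : (x - x') * β = 0 := by
      rw [sub_mul, sub_eq_zero]; exact h
    rw [hβ, h0, zero_mul, map_zero]
  have hsurj : Function.Surjective (LinearMap.mulRight E β) :=
    (LinearMap.injective_iff_surjective).mp hinj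
  obtain ⟨x, hx⟩ := hsurj 1
  exact IsUnit.of_mul_eq_one x (by rw [mul_comm]; exact hx)

/-- Transport to a module with a chosen generator: if `r₀ : L ≃ₗ[L] H` and the `E`-bilinear form
`B` on `H` is `τ`-balanced for the `L`-action (`B(x • u, v) = B(u, τ x • v)`), then its
pull-back `(x, y) ↦ B(r₀ x, r₀ y)` is `τ`-balanced on `L`. [folklore] -/
theorem balanced_pullback {H : Type*} [AddCommGroup H] [Module L H] [Module E H]
    [IsScalarTower E L H] (τ : L →ₐ[E] L) (r₀ : L ≃ₗ[L] H) (B : LinearMap.BilinForm E H)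
    (hB : ∀ (x : L) (u v : H), B (x • u) v = B u (τ x • v)) (x u v : L) :
    B (r₀ (x * u)) (r₀ v) = B (r₀ u) (r₀ (τ x * v)) := by
  rw [← smul_eq_mul, ← smul_eq_mul, LinearEquiv.map_smul, LinearEquiv.map_smul, hB]

end General

section BaseChange

variable {F K E : Type*} [Field F] [Field K] [Field E] [Algebra F K] [Algebra F E]

/-- `Tr_{(E ⊗_F K)/E}(1 ⊗ f) = Tr_{K/F}(f)` (as an element of `E`). [folklore] -/
theorem trace_one_tmul [FiniteDimensional F K] (f : K) :
    Algebra.trace E (E ⊗[F] K) ((1 : E) ⊗ₜ[F] f) = algebraMap F E (Algebra.trace F K f) := by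
  rw [Algebra.trace_apply, Algebra.trace_apply, ← Algebra.baseChange_lmul,
    LinearMap.trace_baseChange]

/-- **The trace form of `E ⊗_F K` over `E` is non-degenerate** for a finite separable field
extension `K/F` and any field extension `E/F`: its Gram matrix in the basis `1 ⊗ bᵢ` is the
image of the Gram matrix of `Tr_{K/F}`, whose determinant is non-zero. [folklore] -/
theorem traceForm_baseChange_nondegenerate [FiniteDimensional F K] [Algebra.IsSeparable F K] :
    (Algebra.traceForm E (E ⊗[F] K)).Nondegenerate := by
  classical
  let b := Module.finBasis F K
  let b' : Basis (Fin (finrank F K)) E (E ⊗[F] K) := Algebra.TensorProduct.basis E b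
  apply LinearMap.BilinForm.nondegenerate_of_det_ne_zero _ b'
  have hM : (Algebra.traceForm E (E ⊗[F] K)).toMatrix b' =
      ((Algebra.traceForm F K).toMatrix b).map (algebraMap F E) := by
    ext i j
    rw [Algebra.traceForm_toMatrix, Matrix.map_apply, Algebra.traceForm_toMatrix]
    simp only [b', Algebra.TensorProduct.basis_apply, Algebra.TensorProduct.tmul_mul_tmul, mul_one]
    exact trace_one_tmul (b i * b j)
  rw [hM, ← RingHom.mapMatrix_apply, ← RingHom.map_det]
  exact (map_ne_zero (algebraMap F E)).mpr (det_traceForm_ne_zero b)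

end BaseChange

section Capstone

variable {F K k₁ E : Type*} [Field F] [Field K] [Field k₁] [Field E] [Algebra F K]
  [Algebra F k₁] [Algebra F E]

/-- `1 ⊗ ρ` is an involution of `E ⊗_F K` when `ρ` is an involution of `K`. [folklore] -/
theorem map_map_of_involutive {K' : Type*} [CommRing K'] [Algebra F K'] (ρ : K' →ₐ[F] K')
    (hρρ : ∀ x, ρ (ρ x) = x) (z : E ⊗[F] K') :
    Algebra.TensorProduct.map (AlgHom.id E E) ρ (Algebra.TensorProduct.map (AlgHom.id E E) ρ z)
      = z := by
  induction z using TensorProduct.induction_on with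
  | zero => simp only [map_zero]
  | tmul a x => rw [Algebra.TensorProduct.map_tmul, Algebra.TensorProduct.map_tmul, hρρ]; rfl
  | add z w hz hw => simp only [map_add, hz, hw]

/-- **Capstone: a Liu-style rigidification exists.** Let `2 ≠ 0` in `F`; `K/F` a finite
separable field extension with an `F`-endomorphism `ρ` restricting along `i : k₁ → K` to a
non-trivial involution `c` of a finite extension `k₁/F`; `E ⊇ F` a field containing all
conjugates of `k₁`; assume `ρ` is an involution and put `L := E ⊗_F K`, `τ := 1 ⊗ ρ`. Let `H` be
an
`L`-module with a generator `r₀ : L ≃ₗ[L] H` and `B` an `E`-bilinear form on `H` which is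
`τ`-balanced (`B(x • u, v) = B(u, τ x • v)`), antisymmetric and left-separating. Then for every
`β ∈ K` with `ρ β = -β`, `β ≠ 0` there is a generator `r : L ≃ₗ[L] H` with
`B(r x, r y) = Tr_{L/E}(x · (1 ⊗ β) · τ y)` for all `x, y ∈ L`. [folklore] -/
theorem exists_generator_eq_trace [NeZero (2 : F)] [FiniteDimensional F K]
    [Algebra.IsSeparable F K] [FiniteDimensional F k₁] (ρ : K →ₐ[F] K) (c : k₁ →ₐ[F] k₁)
    (hc : c ≠ AlgHom.id F k₁) (hcc : ∀ x, c (c x) = x) (i : k₁ →ₐ[F] K)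
    (hρi : ∀ x, ρ (i x) = i (c x)) (hE : Fintype.card (k₁ →ₐ[F] E) = finrank F k₁)
    (hρρ : ∀ x, ρ (ρ x) = x) {H : Type*} [AddCommGroup H] [Module (E ⊗[F] K) H] [Module E H]
    [IsScalarTower E (E ⊗[F] K) H] (r₀ : (E ⊗[F] K) ≃ₗ[E ⊗[F] K] H)
    (B : LinearMap.BilinForm E H)
    (hB : ∀ (x : E ⊗[F] K) (u v : H),
      B (x • u) v = B u (Algebra.TensorProduct.map (AlgHom.id E E) ρ x • v))
    (hanti : ∀ u v, B u v = -B v u) (hsep : ∀ u, (∀ v, B u v = 0) → u = 0)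
    {β : K} (hβ : ρ β = -β) (hβ0 : β ≠ 0) :
    ∃ r : (E ⊗[F] K) ≃ₗ[E ⊗[F] K] H, ∀ x y,
      B (r x) (r y) = Algebra.trace E (E ⊗[F] K)
        (x * ((1 : E) ⊗ₜ[F] β) * Algebra.TensorProduct.map (AlgHom.id E E) ρ y) := by
  set τ := Algebra.TensorProduct.map (AlgHom.id E E) ρ with hτ
  have hττ : ∀ x, τ (τ x) = x := map_map_of_involutive (E := E) ρ hρρ
  -- the pulled-back form on `L`
  let B₀ : LinearMap.BilinForm E (E ⊗[F] K) :=
    B.compl₁₂ (r₀.toLinearMap.restrictScalars E) (r₀.toLinearMap.restrictScalars E)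
  have hB₀ : ∀ x y, B₀ x y = B (r₀ x) (r₀ y) := fun x y => rfl
  have hbal : ∀ x u v, B₀ (x * u) v = B₀ u (τ x * v) := fun x u v => by
    rw [hB₀, hB₀]; exact balanced_pullback τ r₀ B hB x u v
  have hTr := traceForm_baseChange_nondegenerate (F := F) (K := K) (E := E)
  obtain ⟨β₀, hβ₀⟩ := exists_eq_trace_mul_mul_map hTr τ hττ B₀ hbal
  have hanti₀ : ∀ x y, B₀ x y = -B₀ y x := fun x y => by rw [hB₀, hB₀]; exact hanti _ _
  have hτβ₀ : τ β₀ = -β₀ := map_eq_neg_of_antisymm hTr τ hττ B₀ hβ₀ hanti₀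
  have hsep₀ : ∀ x, (∀ y, B₀ x y = 0) → x = 0 := by
    intro x hx
    have : r₀ x = 0 := hsep (r₀ x) fun v => by
      have := hx (r₀.symm v); rwa [hB₀, LinearEquiv.apply_symm_apply] at this
    simpa using this
  have hunit : IsUnit β₀ := isUnit_of_separatingLeft τ B₀ hβ₀ hsep₀
  -- the anti-invariant unit `1 ⊗ β`
  have hβ1 : IsUnit ((1 : E) ⊗ₜ[F] β) := by
    have h := (IsUnit.mk0 β hβ0).map
      (Algebra.TensorProduct.includeRight (R := F) (A := E) (B := K))
    exact h
  have hτβ1 : τ ((1 : E) ⊗ₜ[F] β) = -((1 : E) ⊗ₜ[F] β) := by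
    rw [hτ, Algebra.TensorProduct.map_tmul, hβ, AlgHom.id_apply, TensorProduct.tmul_neg]
  -- the norm step: β₀ = (1 ⊗ β) · a · τ a
  obtain ⟨u, hu, hτu⟩ :=
    exists_sq_eq_one_map_eq_neg_of_intertwines (E := E) i ρ c hc hcc hρi hE
  have h2 : IsUnit (2 : E ⊗[F] K) := by
    have h : IsUnit (algebraMap F (E ⊗[F] K) 2) := (IsUnit.mk0 (2 : F) (NeZero.ne 2)).map _
    rwa [map_ofNat] at h
  haveI : Invertible (2 : E ⊗[F] K) := h2.invertible
  obtain ⟨a, ha, hdec⟩ :=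
    exists_isUnit_eq_mul_norm_of_sq_eq_one τ.toRingHom hu hτu hβ1 hτβ1 hunit hτβ₀
  -- hdec : 1 ⊗ β = β₀ * (a * τ a); the new generator is `r x := r₀ (a * x)`
  refine ⟨(LinearEquiv.smulOfUnit ha.unit).trans r₀, fun x y => ?_⟩
  have hr : ∀ z, ((LinearEquiv.smulOfUnit ha.unit).trans r₀) z = r₀ (a * z) := fun z => rfl
  rw [hr, hr, ← hB₀, hβ₀, hdec]
  congr 1
  have hτa : (τ.toRingHom : E ⊗[F] K → E ⊗[F] K) a = τ a := rfl
  rw [hτa, map_mul τ a y]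
  ring

/-- **Capstone, with `β` produced.** Same hypotheses as `exists_generator_eq_trace` without a
prescribed `β`: there are `β ∈ K` with `ρ β = -β`, `β ≠ 0` and a generator `r : L ≃ₗ[L] H` with
`B(r x, r y) = Tr_{L/E}(x · (1 ⊗ β) · (1 ⊗ ρ) y)`. [folklore] -/
theorem exists_generator_eq_trace' [NeZero (2 : F)] [FiniteDimensional F K]
    [Algebra.IsSeparable F K] [FiniteDimensional F k₁] (ρ : K →ₐ[F] K) (c : k₁ →ₐ[F] k₁)
    (hc : c ≠ AlgHom.id F k₁) (hcc : ∀ x, c (c x) = x) (i : k₁ →ₐ[F] K)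
    (hρi : ∀ x, ρ (i x) = i (c x)) (hE : Fintype.card (k₁ →ₐ[F] E) = finrank F k₁)
    (hρρ : ∀ x, ρ (ρ x) = x) {H : Type*} [AddCommGroup H] [Module (E ⊗[F] K) H] [Module E H]
    [IsScalarTower E (E ⊗[F] K) H] (r₀ : (E ⊗[F] K) ≃ₗ[E ⊗[F] K] H)
    (B : LinearMap.BilinForm E H)
    (hB : ∀ (x : E ⊗[F] K) (u v : H),
      B (x • u) v = B u (Algebra.TensorProduct.map (AlgHom.id E E) ρ x • v))
    (hanti : ∀ u v, B u v = -B v u) (hsep : ∀ u, (∀ v, B u v = 0) → u = 0) :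
    ∃ (β : K) (r : (E ⊗[F] K) ≃ₗ[E ⊗[F] K] H), ρ β = -β ∧ β ≠ 0 ∧ ∀ x y,
      B (r x) (r y) = Algebra.trace E (E ⊗[F] K)
        (x * ((1 : E) ⊗ₜ[F] β) * Algebra.TensorProduct.map (AlgHom.id E E) ρ y) := by
  obtain ⟨β, hβ0, hβ⟩ := exists_ne_zero_map_eq_neg ρ c hc hcc i hρi
  obtain ⟨r, hr⟩ := exists_generator_eq_trace (E := E) ρ c hc hcc i hρi hE hρρ r₀ B hB hanti hsep
    hβ hβ0
  exact ⟨β, r, hβ, hβ0, hr⟩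

end Capstone

end Summit.HodgeConjecture.CorCM.RMuNorm
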